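import Literature.AlgebraicGeometry.Surfaces.K3LatticeInvariantsChernProofs
import Literature.AlgebraicGeometry.Surfaces.K3LatticeInvariantsHolds
import Literature.AlgebraicGeometry.Surfaces.K3TranscendentalLatticeSignatureHolds
import Literature.AlgebraicGeometry.Surfaces.K3HodgeTypesHolds
import Literature.AlgebraicGeometry.HodgeTheory.HypersurfaceHolomorphicFormsProofs
import Literature.AlgebraicGeometry.HodgeTheory.HodgeFiltrationModelsReductionProofs
import Literature.NumberTheory.Transcendental.DeRhamTheoremMultiplicative
import Literature.AlgebraicGeometry.Surfaces.K3SurfaceHodgeGroupsPicardNumber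
import Literature.AlgebraicGeometry.HodgeTheory.BettiHodgeConjectureRankForm
import Literature.AlgebraicGeometry.HodgeTheory.ComplexConjugationHolds
import HarnessLib

/-!
# `b₂ + 4 b₁ = 22` for a K3 surface from the Hirzebruch–Wu relation alone; the three K3 Betti facts are equivalent modulo the signature theorem

Family `hodge`, layer `Literature/AlgebraicGeometry/Surfaces`. Theorems-only companion (D-0026: no
definition, no named fact) of `K3BettiNumbers.lean`, `K3LatticeInvariants.lean` and `K3Marking.lean`.

`K3LatticeInvariantsChernProofs.lean` proves `b₂(S) = 22` for every projective K3 surface `S` from the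
TWO named facts `Literature.Geometry.Symplectic.hirzebruch_firstChernClass_sq_eq_almostComplex_four`
(`⟨c₁², [N]⟩ = 2e + 3τ` on closed almost complex `4`-manifolds — the signature theorem in dimension
four, McDuff–Salamon (4.1.7); its only unproved input in the tree is Thom's `Ω₄ ≅ ℤ`,
`SignatureTheoremFourOfThom.lean`) and `Huybrechts_K3_oddBetti_vanish` (`b₁ = b₃ = 0`, whose residual
is Serre's GAGA comparison for `H¹(S, 𝒪_S)`, `K3BettiNumbersOfGAGA.lean`). Its key step
`IsK3Surface.two_mul_relEuler_add_three_mul_eq_zero` — `2 e(S(ℂ)) + 3 (6 − b₂) = 0` (the signature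
theorem with `c₁ = 0` and the Hodge index theorem `τ = 6 − b₂`) — does NOT use `b₁ = 0`, and neither
does the surface identity `e = 2 − 2b₁ + b₂` (`relEuler_complexPoints_surface`, Poincaré duality
`b₃ = b₁`). Reading them together WITHOUT `b₁ = 0` gives the sharper statement this file records:

* `IsK3Surface.finrank_complexBetti_two_add_four_mul_finrank_one` — **modulo the signature theorem
  alone, `b₂(S) + 4 b₁(S) = 22` for every projective K3 surface** (`0 = 2(2 − 2b₁ + b₂) + 3(6 − b₂)`);
  hence `b₂ ≤ 22`, `b₁ ≤ 5`, and `b₂ = 22 ↔ b₁ = 0`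
  (`finrank_complexBetti_two_le`, `finrank_complexBetti_one_le`, `finrank_complexBetti_two_eq_iff`);
* `Huybrechts_K3_oddBetti_vanish_of_hirzebruch_of_finrank_complexBetti_two` — the CONVERSE of the
  tree's reduction `K3_finrank_complexBetti_two_of_hirzebruch_of_oddBetti`: modulo the signature
  theorem, `b₂ = 22` forces `b₁ = b₃ = 0`; so the two named facts are EQUIVALENT modulo it
  (`K3_finrank_complexBetti_two_iff_oddBetti_vanish_of_hirzebruch`);
* `Huybrechts_K3_marking_exists_iff_finrank_complexBetti_two` — UNCONDITIONALLY, the marking fact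
  (Huybrechts Ch. 1 Prop. 3.5) is equivalent to `b₂ = 22`: a marking is an isomorphism with `ℂ²²`
  (`finrank_complexBetti_two_of_marking`), and conversely the tree's assembly
  `Huybrechts_K3_marking_exists_holds_of` has every other leaf proved (`K3_even_intersectionForm_holds`,
  `K3_exists_orientation_signature_hodgeRiemann_ample_of_finrank_complexBetti_two`,
  `Voisin2002_closedForm_top_zero_not_exact_holds`, `Huybrechts_K3_hodgeTypes_H2_holds`,
  `hodgePQ_independent_of_hodgeModel_holds`, `exists_deRhamIsoFamily_holds`) — stated here at the
  Literature layer (`Huybrechts_K3_marking_exists_of_finrank_complexBetti_two`);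
* `Huybrechts_K3_marking_exists_iff_oddBetti_vanish_of_hirzebruch` — hence, modulo the signature
  theorem, the THREE named facts `Huybrechts_K3_marking_exists`, `K3_finrank_complexBetti_two`,
  `Huybrechts_K3_oddBetti_vanish` are pairwise equivalent: once Thom's theorem lands, the GAGA debt
  `b₁ = 0` is exactly the marking debt, neither more nor less.
* `IsK3Surface.finrank_complexBetti_two_eq_of_le`, `…_of_hodgeClasses_ge`, `…_of_algebraicClasses_ge`
  — since `b₂ = 22 − 4b₁ ∈ {22, 18, 14, …}`, ANY lower bound `b₂(S) ≥ 19` forces `b₂(S) = 22` and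
  `b₁(S) = b₃(S) = 0` modulo the signature theorem; with the tree's `ρ(S) + 2 ≤ b₂(S)`
  (`IsK3Surface.finrank_hodgeClasses_hodge_two_add_two_le`, `p_g = 1`) this holds for every projective
  K3 surface with at least `17` independent rational Hodge (e.g. divisor) classes in `H²` — for those
  surfaces the GAGA input is not needed at all (appended 2026-08-31, same seat).
* `IsK3Surface.exists_marking_of_finrank_complexBetti_two` — the marking theorem PER SURFACE:
  a projective K3 surface `S` with `b₂(S) = 22` carries a marking with a projective period point
  (the body of `Huybrechts_K3_marking_exists` for that `S`), unconditionally — the tree's per-surface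
  lattice theory `marking_of_isEven_of_signature` (Milnor) fed with the proved evenness, the index
  `−16` for the Hodge–Riemann orientation (`exists_orientation_hodgeRiemann_signature`, whose only
  numerical input is `b₂(S) = 22`), the ample `(1,1)`-class and the four analytic `_holds` leaves;
  hence `IsK3Surface.exists_marking_of_hirzebruch_of_algebraicClasses_ge`: **modulo the signature
  theorem alone, every projective K3 surface with `dim_ℂ N¹H²(S) ≥ 17` is marked** (no GAGA input).

Printed source of the arithmetic: Huybrechts, *Lectures on K3 Surfaces*, Ch. 1 §3.3 p. 24
("`Σ (−1)ⁱ bᵢ(X) = 24` … `b₀ = b₄ = 1` … `b₂(X) = 22`") and the proof of Prop. 3.5 (p. 24: the index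
`τ = (c₁² − 2c₂)/3 = −16` by the Thom–Hirzebruch index theorem, `b⁺ = 3` by Hodge index); the tree
replaces Noether's formula by the signature theorem, and this file merely keeps `b₁` as a variable in
that computation. Everything here is proved; the signature theorem enters ONLY as the explicit
hypothesis `hHW` (D-0014). Nothing here discharges `hirzebruch_firstChernClass_sq_eq_almostComplex_four`,
`Huybrechts_K3_oddBetti_vanish`, `K3_finrank_complexBetti_two` or `Huybrechts_K3_marking_exists`.

## References

* [Huybrechts2016K3] D. Huybrechts, *Lectures on K3 Surfaces*, CUP 2016, Ch. 1 §3.3 p. 24, Prop. 3.5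
  and its proof.
* [McDuffSalamon2017] D. McDuff, D. Salamon, *Introduction to Symplectic Topology*, 3rd ed., OUP
  2017, Rem. 4.1.10 (4.1.7).
* [MilnorStasheff1974] J. Milnor, J. Stasheff, *Characteristic Classes* (1974), §19 Thm. 19.4.
* [HatcherAT2002] A. Hatcher, *Algebraic Topology*, CUP 2002, §3.3 Cor. 3.37.
-/

noncomputable section

open scoped Manifold
open Literature.AlgebraicTopology.SingularHomology
open Literature.AlgebraicGeometry.HodgeTheory
open Literature.Geometry.Symplectic

namespace Literature.AlgebraicGeometry.Surfaces

variable {S : Motives.SchemeOver ℂ}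

/-! ### `b₂ + 4 b₁ = 22` modulo the signature theorem -/

/-- **`b₂(S) + 4 b₁(S) = 22` for a projective K3 surface, modulo the signature theorem alone.**
From `2 e + 3 (6 − b₂) = 0` (`IsK3Surface.two_mul_relEuler_add_three_mul_eq_zero`: Hirzebruch–Wu
with `c₁ = 0` and Hodge index `τ = 6 − b₂`) and `e = 2 − 2b₁ + b₂` (`relEuler_complexPoints_surface`,
Poincaré duality `b₃ = b₁`): `0 = 22 − 4b₁ − b₂`. Huybrechts Ch. 1 §3.3 p. 24 with `b₁` kept as a
variable. [cite: Huybrechts2016K3, Ch. 1 §3.3 p. 24 and Prop. 3.5, proof]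
[cite: McDuffSalamon2017, Rem. 4.1.10 (4.1.7)] -/
theorem IsK3Surface.finrank_complexBetti_two_add_four_mul_finrank_one
    (hHW : hirzebruch_firstChernClass_sq_eq_almostComplex_four) (hS : IsK3Surface S) :
    Module.finrank ℂ (HodgeTheory.complexBetti S (2 * 1)) +
      4 * Module.finrank ℂ (HodgeTheory.complexBetti S 1) = 22 := by
  have h := hS.two_mul_relEuler_add_three_mul_eq_zero hHW
  have he := relEuler_complexPoints_surface hS.isSmoothProjective
  change relEuler ℤ ℤ (Motives.ComplexPoints S) ∅ =
    2 - 2 * (Module.finrank ℂ (HodgeTheory.complexBetti S 1) : ℤ) +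
      (Module.finrank ℂ (HodgeTheory.complexBetti S (2 * 1)) : ℤ) at he
  rw [he] at h
  omega

/-- **`b₂(S) ≤ 22` for a projective K3 surface, modulo the signature theorem alone.**
[cite: Huybrechts2016K3, Ch. 1 §3.3 p. 24] -/
theorem IsK3Surface.finrank_complexBetti_two_le
    (hHW : hirzebruch_firstChernClass_sq_eq_almostComplex_four) (hS : IsK3Surface S) :
    Module.finrank ℂ (HodgeTheory.complexBetti S (2 * 1)) ≤ 22 := by
  have h := hS.finrank_complexBetti_two_add_four_mul_finrank_one hHW
  omega

/-- **`b₁(S) ≤ 5` for a projective K3 surface, modulo the signature theorem alone.**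
[cite: Huybrechts2016K3, Ch. 1 §3.3 p. 24] -/
theorem IsK3Surface.finrank_complexBetti_one_le
    (hHW : hirzebruch_firstChernClass_sq_eq_almostComplex_four) (hS : IsK3Surface S) :
    Module.finrank ℂ (HodgeTheory.complexBetti S 1) ≤ 5 := by
  have h := hS.finrank_complexBetti_two_add_four_mul_finrank_one hHW
  omega

/-- **`b₂(S) = 22 ↔ b₁(S) = 0` for a projective K3 surface, modulo the signature theorem alone.**
[cite: Huybrechts2016K3, Ch. 1 §3.3 p. 24] -/
theorem IsK3Surface.finrank_complexBetti_two_eq_iff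
    (hHW : hirzebruch_firstChernClass_sq_eq_almostComplex_four) (hS : IsK3Surface S) :
    Module.finrank ℂ (HodgeTheory.complexBetti S (2 * 1)) = 22 ↔
      Module.finrank ℂ (HodgeTheory.complexBetti S 1) = 0 := by
  have h := hS.finrank_complexBetti_two_add_four_mul_finrank_one hHW
  omega

/-- **`b₃(S) = b₁(S)` for a projective K3 surface** (Poincaré duality on the closed oriented
`4`-manifold `S(ℂ)`, `Motives.ComplexPoints.finrank_singularCohomology_eq_of_add_eq`).
[cite: HatcherAT2002, §3.3 Cor. 3.37] -/
theorem IsK3Surface.finrank_complexBetti_three_eq_one (hS : IsK3Surface S) :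
    Module.finrank ℂ (HodgeTheory.complexBetti S 3) = Module.finrank ℂ (HodgeTheory.complexBetti S 1) :=
  Motives.ComplexPoints.finrank_singularCohomology_eq_of_add_eq ℂ hS.isSmoothProjective
    (p := 3) (q := 1) (by omega)

/-- **Modulo the signature theorem, `b₂(S) = 22` forces `b₁(S) = b₃(S) = 0`** (the odd cohomology
of the compact manifold `S(ℂ)` is finite-dimensional, `finite_singularCohomology_of_compact_chartedSpace`,
so `finrank = 0` means `= 0`).
[cite: Huybrechts2016K3, Ch. 1 §3.3 p. 24] [cite: HatcherAT2002, §3.3 Cor. 3.37] -/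
theorem IsK3Surface.subsingleton_complexBetti_odd_of_finrank_two
    (hHW : hirzebruch_firstChernClass_sq_eq_almostComplex_four) (hS : IsK3Surface S)
    (h22 : Module.finrank ℂ (HodgeTheory.complexBetti S (2 * 1)) = 22) :
    Subsingleton (HodgeTheory.complexBetti S 1) ∧ Subsingleton (HodgeTheory.complexBetti S 3) := by
  have h1 : Module.finrank ℂ (HodgeTheory.complexBetti S 1) = 0 :=
    (hS.finrank_complexBetti_two_eq_iff hHW).1 h22
  have h3 : Module.finrank ℂ (HodgeTheory.complexBetti S 3) = 0 := by
    rw [hS.finrank_complexBetti_three_eq_one, h1]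
  letI := hS.isSmoothProjective.chartedSpace
  haveI := Motives.ComplexPoints.compactSpace_of_isSmoothProjective hS.isSmoothProjective
  haveI := Motives.ComplexPoints.t2Space_of_isSmoothProjective hS.isSmoothProjective
  haveI : Module.Finite ℂ (HodgeTheory.complexBetti S 1) :=
    finite_singularCohomology_of_compact_chartedSpace ℂ ℂ (d := 2 * 2) 1
  haveI : Module.Finite ℂ (HodgeTheory.complexBetti S 3) :=
    finite_singularCohomology_of_compact_chartedSpace ℂ ℂ (d := 2 * 2) 3
  exact ⟨Module.finrank_zero_iff.1 h1, Module.finrank_zero_iff.1 h3⟩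

/-! ### The two named facts `K3_finrank_complexBetti_two` and `Huybrechts_K3_oddBetti_vanish` are equivalent modulo the signature theorem -/

/-- **`Huybrechts_K3_oddBetti_vanish` from the signature theorem and `b₂ = 22`** — the converse of
the tree's `K3_finrank_complexBetti_two_of_hirzebruch_of_oddBetti`. CONDITIONAL on both named facts;
not a discharge. [cite: Huybrechts2016K3, Ch. 1 §3.3 p. 24] -/
theorem Huybrechts_K3_oddBetti_vanish_of_hirzebruch_of_finrank_complexBetti_two
    (hHW : hirzebruch_firstChernClass_sq_eq_almostComplex_four) (h22 : K3_finrank_complexBetti_two) :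
    Huybrechts_K3_oddBetti_vanish :=
  fun S hS => hS.subsingleton_complexBetti_odd_of_finrank_two hHW (h22 S hS)

/-- **Modulo the signature theorem, `b₂ = 22` (for every projective K3 surface) and `b₁ = b₃ = 0`
(for every projective K3 surface) are EQUIVALENT named facts.** [cite: Huybrechts2016K3, Ch. 1 §3.3 p. 24] -/
theorem K3_finrank_complexBetti_two_iff_oddBetti_vanish_of_hirzebruch
    (hHW : hirzebruch_firstChernClass_sq_eq_almostComplex_four) :
    K3_finrank_complexBetti_two ↔ Huybrechts_K3_oddBetti_vanish :=
  ⟨Huybrechts_K3_oddBetti_vanish_of_hirzebruch_of_finrank_complexBetti_two hHW,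
    K3_finrank_complexBetti_two_of_hirzebruch_of_oddBetti hHW⟩

/-! ### The marking fact is equivalent to `b₂ = 22`, unconditionally -/

/-- **`Huybrechts_K3_marking_exists` from `b₂ = 22` alone**, at the Literature layer: the tree's
assembly `Huybrechts_K3_marking_exists_holds_of` fed with the proved evenness of the intersection
form, the signature/Hodge–Riemann/ample package derived from `b₂ = 22`, and the four proved analytic
leaves (top holomorphic forms are not exact, the Hodge types of `H²`, model independence of
`H^{p,q}`, de Rham's theorem). The same statement is proved, with the same one-line proof, in the
summit tree as `Summit.HodgeConjecture.HodgeConjecture.Theorems.NikulinTwinTransport.huybrechts_K3_marking_exists_of_b22`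
(`Theorems/NikulinTwinTransportCruxesOfKugaSatakeOfB22.lean`); it is restated here so that the
Literature layer (which cannot import `Summits`) has the equivalence
`Huybrechts_K3_marking_exists_iff_finrank_complexBetti_two`. CONDITIONAL on `b₂ = 22`; not a discharge.
[cite: Huybrechts2016K3, Ch. 1 Prop. 3.5 and its proof (p. 24)] -/
theorem Huybrechts_K3_marking_exists_of_finrank_complexBetti_two (h22 : K3_finrank_complexBetti_two) :
    Huybrechts_K3_marking_exists :=
  Huybrechts_K3_marking_exists_holds_of h22 K3_even_intersectionForm_holds
    (K3_exists_orientation_signature_hodgeRiemann_ample_of_finrank_complexBetti_two h22)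
    (fun E _ _ _ M _ _ => Voisin2002_closedForm_top_zero_not_exact_holds (E := E) (M := M))
    Huybrechts_K3_hodgeTypes_H2_holds hodgePQ_independent_of_hodgeModel_holds
    fun E _ _ _ => Literature.NumberTheory.Transcendental.exists_deRhamIsoFamily_holds E

/-- **`b₂ = 22` from the marking fact**: a marking is a `ℂ`-linear isomorphism `H²(S(ℂ); ℂ) ≅ ℂ²²`
(`finrank_complexBetti_two_of_marking`). [cite: Huybrechts2016K3, Ch. 1 Prop. 3.5 (p. 24)] -/
theorem K3_finrank_complexBetti_two_of_marking_exists (hm : Huybrechts_K3_marking_exists) :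
    K3_finrank_complexBetti_two := by
  intro S hS
  obtain ⟨η, -⟩ := hm S hS
  exact finrank_complexBetti_two_of_marking η

/-- **The marking fact and `b₂ = 22` are EQUIVALENT named facts (unconditionally).**
[cite: Huybrechts2016K3, Ch. 1 Prop. 3.5 and its proof (p. 24)] -/
theorem Huybrechts_K3_marking_exists_iff_finrank_complexBetti_two :
    Huybrechts_K3_marking_exists ↔ K3_finrank_complexBetti_two :=
  ⟨K3_finrank_complexBetti_two_of_marking_exists, Huybrechts_K3_marking_exists_of_finrank_complexBetti_two⟩

/-! ### Hence all three are equivalent modulo the signature theorem -/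

/-- **`Huybrechts_K3_oddBetti_vanish` from the signature theorem and the marking fact.**
CONDITIONAL; not a discharge. [cite: Huybrechts2016K3, Ch. 1 §3.3 p. 24 and Prop. 3.5] -/
theorem Huybrechts_K3_oddBetti_vanish_of_hirzebruch_of_marking_exists
    (hHW : hirzebruch_firstChernClass_sq_eq_almostComplex_four) (hm : Huybrechts_K3_marking_exists) :
    Huybrechts_K3_oddBetti_vanish :=
  Huybrechts_K3_oddBetti_vanish_of_hirzebruch_of_finrank_complexBetti_two hHW
    (K3_finrank_complexBetti_two_of_marking_exists hm)

/-- **Modulo the signature theorem, the marking fact and `b₁ = b₃ = 0` are EQUIVALENT named facts**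
(through `b₂ = 22`): once Thom's `Ω₄ ≅ ℤ` is in the tree, the GAGA debt `H¹(S, 𝒪_S) = 0 ⟹ b₁ = 0`
is exactly the marking debt. [cite: Huybrechts2016K3, Ch. 1 §3.3 p. 24 and Prop. 3.5] -/
theorem Huybrechts_K3_marking_exists_iff_oddBetti_vanish_of_hirzebruch
    (hHW : hirzebruch_firstChernClass_sq_eq_almostComplex_four) :
    Huybrechts_K3_marking_exists ↔ Huybrechts_K3_oddBetti_vanish :=
  Huybrechts_K3_marking_exists_iff_finrank_complexBetti_two.trans
    (K3_finrank_complexBetti_two_iff_oddBetti_vanish_of_hirzebruch hHW)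

/-! ### Consequence: `b₂ ≥ 19`, in particular `ρ ≥ 17`, forces `b₂ = 22` and `b₁ = b₃ = 0` modulo the signature theorem -/

/-- **Modulo the signature theorem, `19 ≤ b₂(S)` forces `b₂(S) = 22`** (`b₂ = 22 − 4b₁`).
[cite: Huybrechts2016K3, Ch. 1 §3.3 p. 24] -/
theorem IsK3Surface.finrank_complexBetti_two_eq_of_le
    (hHW : hirzebruch_firstChernClass_sq_eq_almostComplex_four) (hS : IsK3Surface S)
    (h19 : 19 ≤ Module.finrank ℂ (HodgeTheory.complexBetti S (2 * 1))) :
    Module.finrank ℂ (HodgeTheory.complexBetti S (2 * 1)) = 22 := by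
  have h := hS.finrank_complexBetti_two_add_four_mul_finrank_one hHW
  omega

/-- **Modulo the signature theorem, `19 ≤ b₂(S)` forces `b₁(S) = b₃(S) = 0`.**
[cite: Huybrechts2016K3, Ch. 1 §3.3 p. 24] -/
theorem IsK3Surface.subsingleton_complexBetti_odd_of_le
    (hHW : hirzebruch_firstChernClass_sq_eq_almostComplex_four) (hS : IsK3Surface S)
    (h19 : 19 ≤ Module.finrank ℂ (HodgeTheory.complexBetti S (2 * 1))) :
    Subsingleton (HodgeTheory.complexBetti S 1) ∧ Subsingleton (HodgeTheory.complexBetti S 3) :=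
  hS.subsingleton_complexBetti_odd_of_finrank_two hHW (hS.finrank_complexBetti_two_eq_of_le hHW h19)

/-- **Modulo the signature theorem, a projective K3 surface with at least `17` independent rational
Hodge classes in `H²` has `b₂ = 22` and `b₁ = b₃ = 0`**: `ρ + 2 ≤ b₂` (`p_g = 1`,
`IsK3Surface.finrank_hodgeClasses_hodge_two_add_two_le`) gives `b₂ ≥ 19`. Here `ρ` is the rank of the
rational Hodge classes of `H²(S)` in the tree's Betti–Hodge universe (for any real Hodge model
witness `hHD`). [cite: Huybrechts2016K3, Ch. 1 §3.3 (3.2)–(3.3) and p. 24] -/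
theorem IsK3Surface.finrank_complexBetti_two_eq_of_hodgeClasses_ge
    (hHW : hirzebruch_firstChernClass_sq_eq_almostComplex_four) (hS : IsK3Surface S)
    (hHD : exists_isReal_hodgeModel)
    (h17 : 17 ≤ Module.finrank ℚ
      ((HodgeTheory.BettiUniverse.hodge hHD hS.isSmoothProjective 2).hodgeClasses 1)) :
    Module.finrank ℂ (HodgeTheory.complexBetti S (2 * 1)) = 22 ∧
      Subsingleton (HodgeTheory.complexBetti S 1) ∧ Subsingleton (HodgeTheory.complexBetti S 3) := by
  have hρ := hS.finrank_hodgeClasses_hodge_two_add_two_le hHD hS.isSmoothProjective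
  have hb : Module.finrank ℂ (HodgeTheory.complexBetti S (2 * 1)) =
      Module.finrank ℚ (Motives.bettiCohomology S 2) :=
    finrank_complexBetti_eq_finrank_bettiCohomology S 2
  have h19 : 19 ≤ Module.finrank ℂ (HodgeTheory.complexBetti S (2 * 1)) := by omega
  exact ⟨hS.finrank_complexBetti_two_eq_of_le hHW h19, hS.subsingleton_complexBetti_odd_of_le hHW h19⟩

/-- **Modulo the signature theorem, a projective K3 surface with `dim_ℂ N¹H²(S) ≥ 17` (at least `17`
independent divisor classes, e.g. Picard number `ρ(S) ≥ 17` in the sense of the summit's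
`algebraicClasses S 1`) has `b₂ = 22` and `b₁ = b₃ = 0`** — WITHOUT the GAGA input
`Huybrechts_K3_oddBetti_vanish`: algebraic classes are rational Hodge classes
(`BettiUniverse.finrank_algebraicClasses_le_finrank_hodgeClasses_hodge`, with the proved real Hodge
model `exists_isReal_hodgeModel_holds`). [cite: Huybrechts2016K3, Ch. 1 §3.3 (3.2)–(3.3) and p. 24] -/
theorem IsK3Surface.finrank_complexBetti_two_eq_of_algebraicClasses_ge
    (hHW : hirzebruch_firstChernClass_sq_eq_almostComplex_four) (hS : IsK3Surface S)
    (h17 : 17 ≤ Module.finrank ℂ (HodgeTheory.algebraicClasses S 1)) :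
    Module.finrank ℂ (HodgeTheory.complexBetti S (2 * 1)) = 22 ∧
      Subsingleton (HodgeTheory.complexBetti S 1) ∧ Subsingleton (HodgeTheory.complexBetti S 3) := by
  have hle := HodgeTheory.BettiUniverse.finrank_algebraicClasses_le_finrank_hodgeClasses_hodge
    exists_isReal_hodgeModel_holds hS.isSmoothProjective 1
  exact hS.finrank_complexBetti_two_eq_of_hodgeClasses_ge hHW exists_isReal_hodgeModel_holds
    (le_trans h17 hle)

/-! ### The marking theorem per surface, from `b₂(S) = 22`; hence markings for `ρ ≥ 17` modulo the signature theorem -/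

/-- **The marking of ONE projective K3 surface with `b₂(S) = 22`** (Huybrechts Ch. 1 Prop. 3.5 and
Ch. 6 Prop. 1.2, for that surface): the conclusion of `Huybrechts_K3_marking_exists` for `S` —
a `ℂ`-linear `η : H²(S(ℂ); ℂ) ≅ ℂ^{Λ_{K3}}` identifying the integral classes with `ℤ²²` and the cup
product with the K3 form, an integral generator `p` of `H⁴`, and the period `x = η(σ)` of the
`(2,0)`-line with `(x.x) = 0`, `(x̄.x) > 0` and an integral `u ⊥ x` of positive square. Proof: the
tree's per-surface Part III `marking_of_isEven_of_signature` (Milnor's classification of even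
indefinite unimodular lattices) fed with the PROVED evenness (`K3_even_intersectionForm_holds`), the
Hodge–Riemann orientation with its ample `(1,1)`-class (`IsK3Surface.exists_orientation_hodgeRiemann_ample`),
its index `−16` (`IsK3Surface.exists_orientation_hodgeRiemann_signature` — the one place `b₂(S) = 22`
enters — and uniqueness of the Hodge–Riemann orientation), a non-zero `(2,0)`-class
(`exists_isOfHodgeType_twoZero_ne_zero`, Voisin I Cor. 7.6 proved), `h^{2,0} ≤ 1`
(`Huybrechts_K3_hodgeTypes_H2_holds`), and the type orthogonalities (`cupProduct_twoZero_self`,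
`cupProduct_oneOne_twoZero`, with `hodgePQ_independent_of_hodgeModel_holds` and de Rham's theorem
`exists_deRhamIsoFamily_holds`). Unconditional given `b₂(S) = 22` for this `S`.
[cite: Huybrechts2016K3, Ch. 1 Prop. 3.5 and its proof (p. 24); Ch. 6 Prop. 1.2; Ch. 14 Cor. 1.3 (i)] -/
theorem IsK3Surface.exists_marking_of_finrank_complexBetti_two (hS : IsK3Surface S)
    (h22 : Module.finrank ℂ (HodgeTheory.complexBetti S (2 * 1)) = 22) :
    ∃ (η : HodgeTheory.complexBetti S (2 * 1) ≃ₗ[ℂ] (K3Index → ℂ))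
      (p : HodgeTheory.complexBetti S (2 * 2)) (x : K3Index → ℂ),
      p ≠ 0 ∧
      (HodgeTheory.IsIntegralClass p ∧
        (∀ q : HodgeTheory.complexBetti S (2 * 2), HodgeTheory.IsIntegralClass q → ∃ n : ℤ, q = n • p) ∧
        (∀ c : HodgeTheory.complexBetti S (2 * 1),
            HodgeTheory.IsIntegralClass c ↔ ∃ v : K3Index → ℤ, η c = fun i => (v i : ℂ)) ∧
        (∀ a b : HodgeTheory.complexBetti S (2 * 1),
            cupProduct (rfl : 2 * 1 + 2 * 1 = 2 * 2) a b = k3Form (η a) (η b) • p) ∧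
        HodgeTheory.IsOfHodgeType 2 S (2 * 1) 2 0 (LinearEquiv.symm η x) ∧
        (∀ τ : HodgeTheory.complexBetti S (2 * 1),
            HodgeTheory.IsOfHodgeType 2 S (2 * 1) 2 0 τ → ∃ t : ℂ, τ = t • LinearEquiv.symm η x)) ∧
      (k3Form x x = 0 ∧ 0 < (k3Form (star x) x).re ∧
        ∃ u : K3Index → ℤ, k3Form (fun i => (u i : ℂ)) x = 0 ∧ 0 < ∑ i, ∑ j, u i * k3Gram i j * u j) := by
  have hV : ∀ (E : Type) [NormedAddCommGroup E] [NormedSpace ℂ E] [FiniteDimensional ℂ E]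
      (M : Type) [TopologicalSpace M] [ChartedSpace E M],
      HodgeTheory.Voisin2002_closedForm_top_zero_not_exact E M :=
    fun E _ _ _ M _ _ => Voisin2002_closedForm_top_zero_not_exact_holds (E := E) (M := M)
  have hdR : ∀ (E : Type) [NormedAddCommGroup E] [NormedSpace ℂ E] [FiniteDimensional ℂ E],
      Literature.NumberTheory.Transcendental.exists_deRhamIsoFamily 𝓘(ℝ, E) :=
    fun E _ _ _ => Literature.NumberTheory.Transcendental.exists_deRhamIsoFamily_holds E
  obtain ⟨A, ηA, hη, hη0⟩ := hS.exists_holomorphicTwoForm_ne_zero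
  obtain ⟨μ, hHR, hsig⟩ := hS.exists_orientation_hodgeRiemann_signature h22 A hη hη0
    (Literature.NumberTheory.Transcendental.integrationDeRhamIsoFamily A.model)
    Literature.NumberTheory.Transcendental.integrationDeRhamIsoFamily_isNatural
    Literature.NumberTheory.Transcendental.integrationDeRhamIsoFamily_isMultiplicative
  obtain ⟨μ', hHR', u, hu11, hupos⟩ := hS.exists_orientation_hodgeRiemann_ample
  have hμ : μ' = μ := hS.orientation_unique_of_hodgeRiemann_twoZero hHR' hHR
  subst hμ
  obtain ⟨σ, hσ0, hσ⟩ := hS.exists_isOfHodgeType_twoZero_ne_zero hV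
  exact marking_of_isEven_of_signature hS.isSmoothProjective μ' h22
    (K3_even_intersectionForm_holds S hS μ') hsig σ hσ
    (fun c => ((Huybrechts_K3_hodgeTypes_H2_holds S hS σ hσ hσ0).1 c).1)
    (hS.cupProduct_twoZero_self hodgePQ_independent_of_hodgeModel_holds hdR hσ) (hHR' σ hσ hσ0)
    ⟨u, hupos, hS.cupProduct_oneOne_twoZero hodgePQ_independent_of_hodgeModel_holds hdR hu11 hσ⟩

/-- **Modulo the signature theorem alone, every projective K3 surface with `dim_ℂ N¹H²(S) ≥ 17`
(e.g. Picard number `≥ 17`: Kummer surfaces, singular K3 surfaces) is marked with a projective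
period point** — the conclusion of `Huybrechts_K3_marking_exists` for `S`, WITHOUT the GAGA input
`Huybrechts_K3_oddBetti_vanish`: `b₂(S) = 22` by `finrank_complexBetti_two_eq_of_algebraicClasses_ge`,
then `exists_marking_of_finrank_complexBetti_two`. CONDITIONAL on
`hirzebruch_firstChernClass_sq_eq_almostComplex_four` only.
[cite: Huybrechts2016K3, Ch. 1 Prop. 3.5 and §3.3 (3.3)] [cite: McDuffSalamon2017, Rem. 4.1.10 (4.1.7)] -/
theorem IsK3Surface.exists_marking_of_hirzebruch_of_algebraicClasses_ge
    (hHW : hirzebruch_firstChernClass_sq_eq_almostComplex_four) (hS : IsK3Surface S)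
    (h17 : 17 ≤ Module.finrank ℂ (HodgeTheory.algebraicClasses S 1)) :
    ∃ (η : HodgeTheory.complexBetti S (2 * 1) ≃ₗ[ℂ] (K3Index → ℂ))
      (p : HodgeTheory.complexBetti S (2 * 2)) (x : K3Index → ℂ),
      p ≠ 0 ∧
      (HodgeTheory.IsIntegralClass p ∧
        (∀ q : HodgeTheory.complexBetti S (2 * 2), HodgeTheory.IsIntegralClass q → ∃ n : ℤ, q = n • p) ∧
        (∀ c : HodgeTheory.complexBetti S (2 * 1),
            HodgeTheory.IsIntegralClass c ↔ ∃ v : K3Index → ℤ, η c = fun i => (v i : ℂ)) ∧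
        (∀ a b : HodgeTheory.complexBetti S (2 * 1),
            cupProduct (rfl : 2 * 1 + 2 * 1 = 2 * 2) a b = k3Form (η a) (η b) • p) ∧
        HodgeTheory.IsOfHodgeType 2 S (2 * 1) 2 0 (LinearEquiv.symm η x) ∧
        (∀ τ : HodgeTheory.complexBetti S (2 * 1),
            HodgeTheory.IsOfHodgeType 2 S (2 * 1) 2 0 τ → ∃ t : ℂ, τ = t • LinearEquiv.symm η x)) ∧
      (k3Form x x = 0 ∧ 0 < (k3Form (star x) x).re ∧
        ∃ u : K3Index → ℤ, k3Form (fun i => (u i : ℂ)) x = 0 ∧ 0 < ∑ i, ∑ j, u i * k3Gram i j * u j) :=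
  hS.exists_marking_of_finrank_complexBetti_two
    (hS.finrank_complexBetti_two_eq_of_algebraicClasses_ge hHW h17).1

end Literature.AlgebraicGeometry.Surfaces

end
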